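import Literature.NumberTheory.ConnesConsani2021.SchwartzKernels
import Literature.NumberTheory.LFunctions.MertensConjectureDisproofProofs
import HarnessLib

/-!
# Connes–Consani 2021, §2 eq. (25)–(26): the closed form of the trace-remainder `δ` is smooth —
# `x ↦ δ(eˣ)` on `[0, ∞)` is the restriction of a real-analytic function (RH-FREE)

LABEL (line 1): **RH-FREE corpus literature.**  Theorems only (no definition, no named fact, no
instance, no `sorry`); companion of `SchwartzKernels.lean` (seat t1 of cell `rh-crit/cc`), where
A. Connes, C. Consani, *Weil positivity and trace formula, the archimedean place*, Selecta Math. (N.S.)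
27 (2021) 77 = arXiv:2006.13771 [bib: `ConnesConsani2021`], §2 Def. 2.1 / Prop. 2.2 / eq. (25)–(26)
(p. 11) are typed: `traceRemainder ρ = traceRemainderAux (max ρ ρ⁻¹)` with the closed form (25)
`traceRemainderAux r = 2√r (Si(2π(1+r))/(2π(1+r)) + Si(2π(r−1))/(2π(r−1)))`, the removable
singularity at `r = 1` filled by `1`, and (26) to first order (`δ′(1⁺) = 1`, `δ′(1⁻) = −1`,
`hasDerivWithinAt_traceRemainder_Ici_one` / `_Iic_one`).

**What is printed.** "`Si(z) := ∫₀ᶻ sin(t)/t dt`: an entire function" (§2 p. 11); "`δ(ρ)` is a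
function" (p. 10); Remark 3.7 (= arXiv Rem. 18, pp. 13–14): "Let `k(x)` be an even function on `ℝ`
whose restriction to `[0,∞)` is a smooth function … Letting then `k(x) := δ(exp|x|)` one obtains
(Qprime)" with "`δ′(1⁺) = 1`" (Thm. 3.6, p. 13).

**What is proved here** (the regularity behind those sentences, for the tree's closed form):
* `contDiff_sinIntegral` — `Si` is `C^∞` (`Si′ = sinc`, `SchwartzKernels.hasDerivAt_sinIntegral`, and
  `sinc` is real analytic: `Literature.NumberTheory.LFunctions.analyticAt_sinc`, REUSED, not restated);
* `hasFPowerSeriesOnBall_intervalIntegral` — termwise integration of a power series at `0`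
  (`y ↦ ∫₀ʸ f` has the coefficients `c₀ = 0`, `c_{n+1} = pₙ/(n+1)` on the same ball);
* `analyticAt_dslope_sinIntegral_zero`, `contDiff_dslope_sinIntegral` — the completed quotient
  `Si(b)/b` (`= dslope Si 0`, value `1` at `b = 0`) is analytic at `0` and `C^∞` on `ℝ`;
* `traceRemainderAux_eq_dslope` — (25) reads `δ(r) = 2√r (Si(2π(1+r))/(2π(1+r)) + dslope Si 0 (2π(r−1)))`;
* **`contDiff_traceRemainderAux_exp`** — `x ↦ traceRemainderAux (eˣ)` is `C^∞` on `ℝ`; it equals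
  `δ(eˣ)` for `x ≥ 0` (`traceRemainder_exp_of_nonneg`, `traceRemainder_exp_abs`) and has derivative
  `1 = δ′(1⁺)` at `0` (`hasDerivAt_traceRemainderAux_exp_zero`);
* the complex-valued avatar `G_δ x := (traceRemainderAux (eˣ) : ℂ)` in the exact shape
  `{G : ℝ → ℂ} (hG : ContDiff ℝ 2 G) (hG1 : deriv G 0 = 1)` under which `JumpFormula.lean` (eq. (Qprime),
  generic in `G`) and `VanishingConditions.lean` (Cor. 3.8, Rem. 3.9 (i), generic in `G`) take CC's
  `k = δ(exp|·|)`: `contDiff_ofReal_traceRemainderAux_exp`, `deriv_ofReal_traceRemainderAux_exp_zero`.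

Cell `rh-crit`, sub-cell `cc/`, seat t1.  bears_on: W-C/W-P (§3 `D₊`-form only; not on the path to
Thm. 1 / apex (A)).  WHAT THIS IS NOT: any claim about RH — nothing in this file bears on the truth of RH.
Import note: `MertensConjectureDisproofProofs` is imported ONLY for `analyticAt_sinc` / `contDiff_sinc`
(dedup: cite, do not restate); this companion keeps that import out of `SchwartzKernels.lean`'s closure.

## References
* A. Connes, C. Consani, *Weil positivity and trace formula, the archimedean place*, Selecta Math. (N.S.)
  27 (2021), Paper No. 77 (arXiv:2006.13771), §2 eq. (25)–(26) p. 11; §3 Rem. 3.7, Thm. 3.6 pp. 13–14.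
  [ConnesConsani2021]
-/

noncomputable section

open _root_.MeasureTheory Complex Set Real FourierTransform
open scoped Real ComplexConjugate ContDiff Topology

namespace Literature.NumberTheory.ConnesConsani2021

open Literature.NumberTheory.LFunctions


/-- `deriv Si = sinc`. [cite: ConnesConsani2021, §2 p. 11 (chunk p0011:L10–L11)] -/
theorem deriv_sinIntegral : deriv sinIntegral = Real.sinc :=
  funext fun x => (hasDerivAt_sinIntegral x).deriv

/-- `Si` is smooth ("an entire function", §2 p. 11). [cite: ConnesConsani2021, §2 p. 11 (chunk p0011:L10–L11)] -/
theorem contDiff_sinIntegral : ContDiff ℝ ∞ sinIntegral := by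
  rw [contDiff_infty_iff_deriv, deriv_sinIntegral]
  exact ⟨fun x => (hasDerivAt_sinIntegral x).differentiableAt, contDiff_sinc⟩

open FormalMultilinearSeries in
/-- Termwise integration of a power series at `0`: if `f = Σ pₙ tⁿ` on the ball of radius `r`, then
`y ↦ ∫₀ʸ f` is `Σ pₙ y^{n+1}/(n+1)` there (the coefficient sequence `c₀ = 0`, `c_{n+1} = pₙ/(n+1)`).
[cite: ConnesConsani2021, §2 p. 11 (chunk p0011:L10–L11)] -/
theorem hasFPowerSeriesOnBall_intervalIntegral {f : ℝ → ℝ} {p : FormalMultilinearSeries ℝ ℝ ℝ}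
    {r : ENNReal} (hf : HasFPowerSeriesOnBall f p 0 r) :
    HasFPowerSeriesOnBall (fun y => ∫ t in (0 : ℝ)..y, f t)
      (ofScalars ℝ (fun n => if n = 0 then (0 : ℝ) else p.coeff (n - 1) / n)) 0 r := by
  set c : ℕ → ℝ := fun n => if n = 0 then (0 : ℝ) else p.coeff (n - 1) / n with hc
  have hc0 : c 0 = 0 := by simp [hc]
  have hcs : ∀ m : ℕ, c (m + 1) = p.coeff m / (m + 1) := fun m => by
    simp [hc]
  refine ⟨?_, hf.r_pos, ?_⟩
  · -- radius
    refine ENNReal.le_of_forall_nnreal_lt fun r' hr' => ?_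
    obtain ⟨C, hC, hCn⟩ := p.norm_mul_pow_le_of_lt_radius (hr'.trans_le hf.r_le)
    refine (ofScalars ℝ c).le_radius_of_bound (C * r') fun n => ?_
    rcases n with _ | m
    · simp [hc0]; positivity
    · rw [ofScalars_norm, hcs, pow_succ, ← mul_assoc]
      have h1 : ‖p.coeff m / (m + 1 : ℝ)‖ ≤ ‖p m‖ := by
        rw [norm_div, norm_apply_eq_norm_coef]
        refine div_le_self (norm_nonneg _) ?_
        rw [Real.norm_eq_abs, abs_of_pos (by positivity)]
        exact_mod_cast Nat.le_add_left 1 m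
      calc ‖p.coeff m / (m + 1 : ℝ)‖ * (r' : ℝ) ^ m * r'
          ≤ ‖p m‖ * (r' : ℝ) ^ m * r' := by gcongr
        _ ≤ C * r' := by gcongr; exact hCn m
  · -- the sum
    intro y hy
    rw [zero_add]
    have hy' : (‖y‖₊ : ENNReal) < p.radius := by
      refine lt_of_lt_of_le ?_ hf.r_le
      simpa [edist_zero_right, enorm_eq_nnnorm] using hy
    rw [← hasSum_nat_add_iff' 1]
    simp only [Finset.range_one, Finset.sum_singleton, ofScalars_apply_eq, smul_eq_mul, hc0,
      zero_mul, sub_zero, hcs]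
    -- termwise integration
    have hterm : ∀ m : ℕ, ∫ t in (0 : ℝ)..y, p.coeff m * t ^ m = p.coeff m / (m + 1) * y ^ (m + 1) := by
      intro m
      rw [intervalIntegral.integral_const_mul, integral_pow]
      simp [zero_pow (Nat.succ_ne_zero m)]
      ring
    have key := intervalIntegral.hasSum_integral_of_dominated_convergence (μ := volume) (a := 0) (b := y)
      (F := fun (m : ℕ) (t : ℝ) => p.coeff m * t ^ m) (f := f)
      (fun m _ => ‖p m‖ * ‖y‖ ^ m)
      (fun m => (by fun_prop : Continuous fun t : ℝ => p.coeff m * t ^ m).aestronglyMeasurable)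
      (fun m => Filter.Eventually.of_forall fun t ht => by
        have hty : |t| ≤ |y| := by
          rcases Set.mem_uIoc.mp ht with h | h
          · rw [abs_of_pos h.1]; exact h.2.trans (le_abs_self y)
          · rw [abs_of_nonpos h.2, abs_of_nonpos (h.1.le.trans h.2)]; linarith [h.1]
        have hty' : ‖t‖ ≤ ‖y‖ := by simpa [Real.norm_eq_abs] using hty
        rw [norm_mul, norm_pow, ← norm_apply_eq_norm_coef]
        gcongr)
      (Filter.Eventually.of_forall fun t _ => by
        simpa using p.summable_norm_mul_pow hy')
      intervalIntegrable_const
      (Filter.Eventually.of_forall fun t ht => by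
        have hty : |t| ≤ |y| := by
          rcases Set.mem_uIoc.mp ht with h | h
          · rw [abs_of_pos h.1]; exact h.2.trans (le_abs_self y)
          · rw [abs_of_nonpos h.2, abs_of_nonpos (h.1.le.trans h.2)]; linarith [h.1]
        have hty' : ‖t‖ ≤ ‖y‖ := by simpa [Real.norm_eq_abs] using hty
        have hnn : ‖t‖₊ ≤ ‖y‖₊ := by exact_mod_cast hty'
        have ht' : t ∈ Metric.eball (0 : ℝ) r := by
          rw [Metric.mem_eball, edist_zero_right, enorm_eq_nnnorm] at hy ⊢
          exact lt_of_le_of_lt (ENNReal.coe_le_coe.mpr hnn) hy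
        have := hf.hasSum ht'
        simpa [apply_eq_pow_smul_coeff, mul_comm] using this)
    simpa [hterm] using key

/-- The completed quotient `Si(b)/b` (value `1` at `b = 0`), i.e. `dslope Si 0`, is real analytic at
`b = 0`. [cite: ConnesConsani2021, §2 eq. (25)–(26) p. 11 (chunk p0011:L10–L17)] -/
theorem analyticAt_dslope_sinIntegral_zero : AnalyticAt ℝ (dslope sinIntegral 0) 0 := by
  obtain ⟨p, r, hp⟩ := analyticAt_sinc 0
  have h := hasFPowerSeriesOnBall_intervalIntegral hp
  have heq : (fun y => ∫ t in (0 : ℝ)..y, Real.sinc t) = sinIntegral :=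
    funext fun y => (sinIntegral_eq_integral_sinc y).symm
  rw [heq] at h
  exact h.hasFPowerSeriesAt.has_fpower_series_dslope_fslope.analyticAt

/-- `dslope Si 0` is smooth on `ℝ`. [cite: ConnesConsani2021, §2 eq. (25)–(26) p. 11 (chunk p0011:L10–L17)] -/
theorem contDiff_dslope_sinIntegral : ContDiff ℝ ∞ (dslope sinIntegral 0) := by
  refine contDiff_iff_contDiffAt.mpr fun b => ?_
  rcases eq_or_ne b 0 with rfl | hb
  · exact analyticAt_dslope_sinIntegral_zero.contDiffAt
  · have h : ContDiffAt ℝ ∞ (fun b : ℝ => (sinIntegral b - sinIntegral 0) / (b - 0)) b :=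
      (contDiff_sinIntegral.sub contDiff_const).contDiffAt.div
        (contDiffAt_id.sub contDiffAt_const) (by simpa using hb)
    refine h.congr_of_eventuallyEq ?_
    filter_upwards [eventually_ne_nhds hb] with b' hb'
    rw [dslope_of_ne _ hb', slope_def_field]

/-- `dslope Si 0 (b) = Si(b)/b` for `b ≠ 0` and `= 1` at `b = 0`: the closed form (25) is
`δ(r) = 2√r (Si(2π(1+r))/(2π(1+r)) + dslope Si 0 (2π(r−1)))`.
[cite: ConnesConsani2021, §2 eq. (25) p. 11 (chunk p0011:L12)] -/
theorem traceRemainderAux_eq_dslope (r : ℝ) : traceRemainderAux r =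
    2 * Real.sqrt r * (sinIntegral (2 * π * (1 + r)) / (2 * π * (1 + r)) +
      dslope sinIntegral 0 (2 * π * (r - 1))) := by
  simp only [traceRemainderAux]
  congr 2
  split_ifs with h
  · rw [h, sub_self, mul_zero, dslope_same, (hasDerivAt_sinIntegral 0).deriv, Real.sinc_zero]
  · have hb : 2 * π * (r - 1) ≠ 0 := mul_ne_zero (by positivity) (sub_ne_zero.mpr h)
    rw [dslope_of_ne _ hb, slope_def_field, sinIntegral_zero, sub_zero, sub_zero]

/-- **The closed form of `δ ∘ exp` is smooth on `ℝ`**: `x ↦ traceRemainderAux (eˣ)` is `C^∞`; on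
`x ≥ 0` it is `δ(eˣ)` (`traceRemainder_exp_of_nonneg`), so it is a smooth two-sided extension of
`x ↦ δ(e^{|x|})|_{[0,∞)}` — the function `k|_{[0,∞)}` of Remark 3.7 / Theorem 3.6 with `k(x) = δ(exp|x|)`.
[cite: ConnesConsani2021, §2 eq. (25)–(26) p. 11; §3 Rem. 3.7 pp. 13–14 (arXiv Rem. 18)] -/
theorem contDiff_traceRemainderAux_exp :
    ContDiff ℝ ∞ (fun x : ℝ => traceRemainderAux (Real.exp x)) := by
  have hsq : ∀ x : ℝ, Real.sqrt (Real.exp x) = Real.exp (x / 2) := fun x => by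
    rw [show Real.exp x = Real.exp (x / 2) ^ 2 by rw [← Real.exp_nat_mul]; ring_nf,
      Real.sqrt_sq (Real.exp_pos _).le]
  have heq : (fun x : ℝ => traceRemainderAux (Real.exp x)) = fun x =>
      2 * Real.exp (x / 2) * (sinIntegral (2 * π * (1 + Real.exp x)) / (2 * π * (1 + Real.exp x)) +
        dslope sinIntegral 0 (2 * π * (Real.exp x - 1))) := by
    funext x; rw [traceRemainderAux_eq_dslope, hsq]
  rw [heq]
  refine (contDiff_const.mul (Real.contDiff_exp.comp (contDiff_id.div_const 2))).mul
    (ContDiff.add ?_ ?_)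
  · refine ContDiff.div ?_ ?_ fun x => by positivity
    · exact contDiff_sinIntegral.comp (contDiff_const.mul (contDiff_const.add Real.contDiff_exp))
    · exact contDiff_const.mul (contDiff_const.add Real.contDiff_exp)
  · exact contDiff_dslope_sinIntegral.comp (contDiff_const.mul (Real.contDiff_exp.sub contDiff_const))

/-- On `x ≥ 0`, `δ(eˣ)` IS the closed form. [cite: ConnesConsani2021, §2 eq. (25) p. 11 (chunk p0011:L12)] -/
theorem traceRemainder_exp_of_nonneg {x : ℝ} (hx : 0 ≤ x) :
    traceRemainder (Real.exp x) = traceRemainderAux (Real.exp x) :=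
  traceRemainder_of_one_le (Real.one_le_exp hx)

/-- `δ(e^{|x|}) = traceRemainderAux (e^{|x|})` for every `x`: the even function `k(x) = δ(exp|x|)` of
Remark 3.7 is `G ∘ |·|` with `G = traceRemainderAux ∘ exp` smooth. [cite: ConnesConsani2021, §3 Rem. 3.7 pp. 13–14 (arXiv Rem. 18)] -/
theorem traceRemainder_exp_abs (x : ℝ) :
    traceRemainder (Real.exp |x|) = traceRemainderAux (Real.exp |x|) :=
  traceRemainder_exp_of_nonneg (abs_nonneg x)

/-- `(d/dx) traceRemainderAux(eˣ) |_{x=0} = δ′(1⁺) = 1`. [cite: ConnesConsani2021, §2 eq. (26) p. 11 (chunk p0011:L15–L17)] -/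
theorem hasDerivAt_traceRemainderAux_exp_zero :
    HasDerivAt (fun x : ℝ => traceRemainderAux (Real.exp x)) 1 0 := by
  have h1 : HasDerivAt traceRemainderAux 1 (Real.exp 0) := by
    rw [Real.exp_zero]; exact hasDerivAt_traceRemainderAux_one
  simpa [Function.comp_def] using h1.comp 0 (Real.hasDerivAt_exp 0)

/-- The complex-valued density `G_δ(x) := traceRemainderAux (eˣ)` (the shape `G : ℝ → ℂ`,
`ContDiff ℝ 2 G`, `deriv G 0 = 1` in which `JumpFormula` / `VanishingConditions` take CC's `k = δ(exp|·|)`)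
is smooth. [cite: ConnesConsani2021, §3 Rem. 3.7 pp. 13–14 (arXiv Rem. 18); Thm. 3.6 eq. (Qprime) p. 13] -/
theorem contDiff_ofReal_traceRemainderAux_exp {n : WithTop ℕ∞} (hn : n ≤ ∞) :
    ContDiff ℝ n (fun x : ℝ => ((traceRemainderAux (Real.exp x) : ℝ) : ℂ)) :=
  (Complex.ofRealCLM.contDiff.comp contDiff_traceRemainderAux_exp).of_le hn

/-- … and has derivative `1 = δ′(1⁺)` at `0`. [cite: ConnesConsani2021, §2 eq. (26) p. 11; §3 Thm. 3.6 eq. (Qprime) p. 13 ("`δ′(1⁺) = 1`")] -/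
theorem hasDerivAt_ofReal_traceRemainderAux_exp_zero :
    HasDerivAt (fun x : ℝ => ((traceRemainderAux (Real.exp x) : ℝ) : ℂ)) 1 0 := by
  simpa using hasDerivAt_traceRemainderAux_exp_zero.ofReal_comp

/-- `deriv` form of the previous statement. [cite: ConnesConsani2021, §2 eq. (26) p. 11 (chunk p0011:L15–L17)] -/
theorem deriv_ofReal_traceRemainderAux_exp_zero :
    deriv (fun x : ℝ => ((traceRemainderAux (Real.exp x) : ℝ) : ℂ)) 0 = 1 :=
  hasDerivAt_ofReal_traceRemainderAux_exp_zero.deriv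

end Literature.NumberTheory.ConnesConsani2021

end
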